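import Summits.Ventures.HSemireg.Pad4TowerPsiSubA1
import Summits.Ventures.HSemireg.Pad4TowerDiamondMu4

/-!
# Phase-torus law at DESIGN level — the dictionary (M)(T) over the tree's 𝔅(μ₄) vocabulary (SPEC by control g5; typing target R19.132, third stage)

Crux of record `…Theses.EightfoldBlochSeeds.BlochSeedDiscOne` (stmt-HodgeConjecture-18881).  Nothing here proves HC, HC_AV, HC_CM,
H2 or 18881; census-neutral; no fact, no instance, no notation.  SORRY-FREE (signatures FIXED by this seat; bodies: K3a + §1c control g5, K3b = §1b hsemireg-phasetorus-typer-1 g0,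
K3c = §4b + UP body s4-prove-1 g32).  Pen proof: `Cruxes/BlochSeedDiscOne/PHASE-TORUS-LAW-g5.md` v1.1 §1–§2 (M)(T), ×2 idea-crit-6 (bus 2026-08-29T11:08:17Z).

OBJECTS OF RECORD USED: `MCell`, `MConfig`, `MCell.le` (`P ≤ N` :⇔ `N − P` effective on every factor = the live-pair relation),
`MCell.ch`, `MConfig.wch` (weighted class tensor `Σ_N m_N ch(N) − Σ_P m_P ch(P)`), `ClassScreen` (= (A1), `ch ∈ ℚ[h] ⊕ W`), `eWord`
(`Pad4TowerCrossPhase`, `Pad4TowerPsiSubA1`, `Pad4TowerClassScreen`).  Convention `β = c·conj(i^k)` (`step k`).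

CONTENT (statements; bodies sorried):
* §1 LINE letters `lineLetter h c k = (h − c, c·Re conj(i^k), c·Im conj(i^k))`, `LineCell h Z`; per-factor moment letters
  `(1, c, β, β̄)` and the design MOMENTS `MConfig.moment mN mP w` over moment words `w : Fin 4 → Fin 4`.
* §2 (M), the direction the law needs: on a LINE configuration, (A1) ⇒ every TOP mixed moment (all four letters non-unit) vanishes
  except `ββββ`, `β̄β̄β̄β̄`; and `wch eWord = moment ββββ` (= μ).  [`topMoment_eq_zero_of_classScreen`, `wch_eWord_eq_moment_beta`]
* §3 flows: `UpFlow` (P-saturating flow along live pairs `P ≤ N`, N-capacity `m_N`; = König–Egerváry form of «generic rank = Σ m_P»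
  for a cokernel presentation `⊕P → ⊕N → 𝓔 → 0`), `DownFlow` (pairs `N ≤ P`; kernel presentation `0 → 𝓔 → ⊕N → ⊕P`), residuals.
* §4 THE LAW AT DESIGN LEVEL: `lineTwoTermDown_mu_eq_zero` (every rank) and `lineTwoTermUp_mu_eq_zero` (rank ≤ 4, from the
  finite phase-torus law — passed as the hypothesis `hPT`, verbatim the `Prop` `PhaseTorusLaw` of `Cruxes/…/PhaseTorusLaw.lean`,
  to be discharged by `phaseTorusLaw_holds` once `Summits/Ventures/HSemireg/PhaseTorusLaw.lean` is in the tree).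
-/

namespace Summit.HodgeConjecture.HodgeConjecture.Cruxes.BlochSeedDiscOne.LinePhaseTorus

open Finset BigOperators Summit.Ventures.HSemireg Summit.Ventures.HSemireg.Pad4Tower

/-! ## §1 LINE letters and design moments -/

/-- the LINE-`h` letter of charge `c` and phase `k`: `(α, β) = (h − c, c·conj(i^k))`. -/
def lineLetter (h : ℤ) (c : ℕ) (k : Fin 4) : BPoint :=
  (h - c, (c : ℤ) * ![1, 0, -1, 0] k, (c : ℤ) * ![0, -1, 0, 1] k)

/-- a cell all of whose letters lie on the LINE `α + c = h`. -/
def LineCell (h : ℤ) (Z : MCell) : Prop := ∀ f, ∃ c : ℕ, ∃ k : Fin 4, Z f = lineLetter h c k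

/-- the charge `c_f = h − α_f` of a LINE cell's letter. -/
def lineCharge (h : ℤ) (Z : MCell) (f : Fin 4) : ℤ := h - (Z f).1

/-- `β_f` as a Gaussian integer. -/
def betaG (Z : MCell) (f : Fin 4) : GaussianInt := ⟨(Z f).2.1, (Z f).2.2⟩

/-- the per-factor MOMENT LETTERS `0,1,2,3 = 1, c, β, β̄`. -/
def mletter (h : ℤ) (Z : MCell) (f : Fin 4) : Fin 4 → GaussianInt :=
  ![1, (lineCharge h Z f : GaussianInt), betaG Z f, star (betaG Z f)]

/-- the monomial of a cell at a moment word `w`. -/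
def MCell.mono (h : ℤ) (Z : MCell) (w : Fin 4 → Fin 4) : GaussianInt := ∏ f, mletter h Z f (w f)

/-- the design MOMENT `N(w) = Σ_N m_N mono(N,w) − Σ_P m_P mono(P,w)`. -/
def moment (h : ℤ) (C : MConfig) (mN mP : MCell → ℤ) (w : Fin 4 → Fin 4) : GaussianInt :=
  ∑ Z ∈ C.lower, mN Z • MCell.mono h Z w - ∑ P ∈ C.upper, mP P • MCell.mono h P w

/-- a TOP word: no unit letter. -/
def TopWord (w : Fin 4 → Fin 4) : Prop := ∀ f, w f ≠ 0


/-! ## §1a letter calculus on the line (control g5, K3a bodies) -/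

/-- the unit `conj(i^k)` as a Gaussian integer. -/
def unitG (k : Fin 4) : GaussianInt := ⟨![1, 0, -1, 0] k, ![0, -1, 0, 1] k⟩

theorem lineCharge_of_eq {h : ℤ} {Z : MCell} {f : Fin 4} {c : ℕ} {k : Fin 4} (hZ : Z f = lineLetter h c k) :
    lineCharge h Z f = c := by
  simp [lineCharge, hZ, lineLetter]

theorem betaG_of_eq {h : ℤ} {Z : MCell} {f : Fin 4} {c : ℕ} {k : Fin 4} (hZ : Z f = lineLetter h c k) :
    betaG Z f = (c : GaussianInt) * unitG k := by
  rw [betaG, hZ, Zsqrtd.ext_iff]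
  simp [lineLetter, unitG]

theorem lineCharge_nonneg {h : ℤ} {Z : MCell} (hZ : LineCell h Z) (f : Fin 4) : 0 ≤ lineCharge h Z f := by
  obtain ⟨c, k, e⟩ := hZ f
  rw [lineCharge_of_eq e]; exact_mod_cast Nat.zero_le c

theorem betaG_eq_zero_of_lineCharge {h : ℤ} {Z : MCell} (hZ : LineCell h Z) (f : Fin 4)
    (h0 : lineCharge h Z f = 0) : betaG Z f = 0 := by
  obtain ⟨c, k, e⟩ := hZ f
  rw [lineCharge_of_eq e] at h0
  rw [betaG_of_eq e]
  have : c = 0 := by exact_mod_cast h0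
  simp [this]

/-- THE SLIDE LEMMA (letter level): an effective difference between two LINE letters lowers the charge, along the
same ray unless it reaches the apex: `c' ≤ c` and (`c' = 0` or same phase). -/
theorem slide_letter (h : ℤ) {c c' : ℕ} {k k' : Fin 4}
    (he : Effective (bsub (lineLetter h c' k') (lineLetter h c k))) : c' ≤ c ∧ (c' = 0 ∨ k' = k) := by
  rcases he with ⟨h1, h2⟩
  have hc : (c' : ℤ) ≤ c := by
    simp only [lineLetter] at h1; linarith
  refine ⟨by exact_mod_cast hc, ?_⟩
  have hc0 : (0 : ℤ) ≤ c' := by exact_mod_cast Nat.zero_le c'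
  fin_cases k <;> fin_cases k' <;> simp [lineLetter] at h2 ⊢ <;>
    first
    | trivial
    | (rcases Nat.eq_zero_or_pos c' with h0 | h0
       · exact h0
       · exfalso
         have h0' : (0 : ℤ) < c' := by exact_mod_cast h0
         nlinarith)

/-- THE SLIDE LEMMA (cell level). -/
theorem slide {h : ℤ} {Z P : MCell} (hZ : LineCell h Z) (hP : LineCell h P) (hle : MCell.le Z P) (f : Fin 4) :
    lineCharge h P f ≤ lineCharge h Z f ∧
      (lineCharge h P f = 0 ∨ (lineCharge h P f = lineCharge h Z f → P f = Z f)) := by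
  obtain ⟨c, k, e⟩ := hZ f
  obtain ⟨c', k', e'⟩ := hP f
  have he : Effective (bsub (lineLetter h c' k') (lineLetter h c k)) := by
    have := hle f; rwa [e, e'] at this
  obtain ⟨hcc, hk⟩ := slide_letter h he
  rw [lineCharge_of_eq e, lineCharge_of_eq e']
  refine ⟨by exact_mod_cast hcc, ?_⟩
  rcases hk with h0 | hk
  · left; exact_mod_cast h0
  · right; intro hce
    have : c' = c := by exact_mod_cast hce
    rw [e, e', this, hk]

theorem mono_one (h : ℤ) (Z : MCell) :
    MCell.mono h Z (fun _ => 1) = ((∏ f, lineCharge h Z f : ℤ) : GaussianInt) := by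
  simp [MCell.mono, mletter]

theorem mono_two (h : ℤ) (Z : MCell) : MCell.mono h Z (fun _ => 2) = ∏ f, betaG Z f := by
  simp [MCell.mono, mletter]

theorem v_nonneg {h : ℤ} {Z : MCell} (hZ : LineCell h Z) : 0 ≤ ∏ f, lineCharge h Z f :=
  Finset.prod_nonneg fun f _ => lineCharge_nonneg hZ f

theorem v_le {h : ℤ} {Z P : MCell} (hZ : LineCell h Z) (hP : LineCell h P) (hle : MCell.le Z P) :
    ∏ f, lineCharge h P f ≤ ∏ f, lineCharge h Z f :=
  Finset.prod_le_prod (fun f _ => lineCharge_nonneg hP f) fun f _ => (slide hZ hP hle f).1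

theorem b_eq_zero_of_v {h : ℤ} {Z : MCell} (hZ : LineCell h Z) (hv : ∏ f, lineCharge h Z f = 0) :
    ∏ f, betaG Z f = 0 := by
  obtain ⟨f, -, hf⟩ := Finset.prod_eq_zero_iff.mp hv
  exact Finset.prod_eq_zero (Finset.mem_univ f) (betaG_eq_zero_of_lineCharge hZ f hf)

theorem b_eq_of_v_eq {h : ℤ} {Z P : MCell} (hZ : LineCell h Z) (hP : LineCell h P) (hle : MCell.le Z P)
    (hv : ∏ f, lineCharge h P f = ∏ f, lineCharge h Z f) : ∏ f, betaG P f = ∏ f, betaG Z f := by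
  by_cases h0 : ∏ f, lineCharge h P f = 0
  · rw [b_eq_zero_of_v hP h0, b_eq_zero_of_v hZ (hv ▸ h0)]
  · have hpos : ∀ f, 0 < lineCharge h P f := fun f =>
      lt_of_le_of_ne (lineCharge_nonneg hP f) fun e => h0 (Finset.prod_eq_zero (Finset.mem_univ f) e.symm)
    have heq : ∀ g, P g = Z g := by
      intro g
      by_contra hne
      have hlt : lineCharge h P g < lineCharge h Z g :=
        lt_of_le_of_ne (slide hZ hP hle g).1 fun e =>
          hne (((slide hZ hP hle g).2.resolve_left (ne_of_gt (hpos g))) e)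
      have := Finset.prod_lt_prod (s := Finset.univ) (fun f _ => hpos f) (fun f _ => (slide hZ hP hle f).1)
        ⟨g, Finset.mem_univ _, hlt⟩
      exact absurd hv (ne_of_lt this)
    have : P = Z := funext heq
    rw [this]

/-- the `eeee`-coefficient of a cell's class tensor is `Π_f β_f`. -/
theorem ch_eWord (Z : MCell) : Z.ch eWord = ∏ f, betaG Z f := by
  simp only [MCell.ch, chTensor, bphi, phiVec, eWord, betaG, Fin.prod_univ_four]
  simp only [Matrix.cons_val]

/-! ## §1b slot calculus for (M) (phasetorus-typer-1 g0, K3b body)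

Every moment letter is a two-term combination of CLASS letters of the same factor: `1 = [1]`, `c = h·[1] − [u]` (by the
definition of `lineCharge`, no line hypothesis), `β = [e]`, `β̄ = [ē]`.  Hence the monomial of a cell at a moment word `m`
is the expansion `Σ_{x : Fin 4 → Fin 2} A(x) · ch(Z)(W x)` over slot choices (`Fintype.prod_sum`), and the design moment is
`Σ_x A(x) · wch(W x)`.  If `m` carries a `β` or `β̄` letter and is not `ββββ`, `β̄β̄β̄β̄`, EVERY class word `W x` is e-mixed
and differs from `eeee`, `ēēēē`, so (A1)(i) kills each term: the `2^{#u}` words of the `u`-expansion die one by one (no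
triangular elimination, no induction).  The remaining top word `cccc` is the Ψ-row: on a LINE cell `12Ψ = 12·Π_f c_f`
(LEMMA Ψ-LINE, cf. `Pad4TowerPsiLine.MCell.psi12_ceiling`), and `Λ₁₂(wch) = 0` under (A1) (`lamTwelve_eq_zero_of_classScreen`,
`MCell.lamTwelve_ch`) — Λ is the degree-2 → 3 → 4 elimination packaged as one e-free annihilator. -/

/-- coefficients of the two-term slot decomposition of the moment letters `0,1,2,3 = 1, c, β, β̄`:
`1 = 1·[1] + 0`, `c = h·[1] − 1·[u]`, `β = 1·[e] + 0`, `β̄ = 1·[ē] + 0`. -/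
def slotCoef (h : ℤ) : Fin 4 → Fin 2 → GaussianInt :=
  ![![1, 0], ![(h : GaussianInt), -1], ![1, 0], ![1, 0]]

/-- class letters (`0..5 = 1, u, v, e, ē, p`) of the two-term slot decomposition of the moment letters. -/
def slotLetter : Fin 4 → Fin 2 → Fin 6 :=
  ![![0, 0], ![0, 1], ![3, 3], ![4, 4]]

/-- the CLASS WORD of the slot choice `x` at the moment word `m`. -/
def slotWord (m : Fin 4 → Fin 4) (x : Fin 4 → Fin 2) : CWord := fun f => slotLetter (m f) (x f)

/-- the coefficient `A(x) = Π_f a(m_f, x_f)` of the slot choice `x` at the moment word `m`. -/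
def slotA (h : ℤ) (m : Fin 4 → Fin 4) (x : Fin 4 → Fin 2) : GaussianInt := ∏ f, slotCoef h (m f) (x f)

/-- the `1`-slot of a letter vector is `1`. -/
theorem bphi_zero (x : BPoint) : bphi x 0 = 1 := by
  simp [bphi, phiVec]

/-- the `u`-slot of a letter vector is `α`. -/
theorem bphi_one (x : BPoint) : bphi x 1 = (x.1 : GaussianInt) := by
  simp [bphi, phiVec]

/-- the `e`-slot of a letter vector is `β`. -/
theorem bphi_three (x : BPoint) : bphi x 3 = ⟨x.2.1, x.2.2⟩ := by
  simp only [bphi, phiVec]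
  simp only [Matrix.cons_val]

/-- the `ē`-slot of a letter vector is `β̄`. -/
theorem bphi_four (x : BPoint) : bphi x 4 = ⟨x.2.1, -x.2.2⟩ := by
  simp only [bphi, phiVec]
  simp only [Matrix.cons_val]

/-- THE SLOT DECOMPOSITION of every moment letter (no line hypothesis: `c := h − α` by definition). -/
theorem mletter_eq_slot (h : ℤ) (Z : MCell) (f : Fin 4) (l : Fin 4) :
    mletter h Z f l = ∑ j : Fin 2, slotCoef h l j * bphi (Z f) (slotLetter l j) := by
  fin_cases l
  · simp [mletter, slotCoef, slotLetter, Fin.sum_univ_two, bphi_zero]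
  · simp only [mletter, slotCoef, slotLetter, Fin.sum_univ_two, lineCharge]
    simp only [Fin.mk_one, Fin.isValue, Matrix.cons_val_one, Matrix.cons_val_zero, Matrix.cons_val_fin_one,
      Int.cast_sub, bphi_zero, bphi_one]
    ring
  · simp only [mletter, slotCoef, slotLetter, Fin.sum_univ_two, betaG]
    simp [bphi_three]
  · simp only [mletter, slotCoef, slotLetter, Fin.sum_univ_two, betaG]
    simp [bphi_four]

/-- the class tensor of a cell as a product over the factors. -/
theorem ch_eq_prod (Z : MCell) (w : CWord) : Z.ch w = ∏ f, bphi (Z f) (w f) := by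
  simp only [MCell.ch, chTensor, Fin.prod_univ_four]

/-- the monomial of a cell at `m` is the slot expansion of its class tensor. -/
theorem mono_eq_sum_slot (h : ℤ) (Z : MCell) (m : Fin 4 → Fin 4) :
    MCell.mono h Z m = ∑ x : Fin 4 → Fin 2, slotA h m x * Z.ch (slotWord m x) := by
  unfold MCell.mono
  simp_rw [mletter_eq_slot]
  rw [Fintype.prod_sum]
  refine Finset.sum_congr rfl fun x _ => ?_
  rw [Finset.prod_mul_distrib, ch_eq_prod]
  rfl

/-- the design moment at `m` is the slot expansion of the weighted class tensor. -/
theorem moment_eq_sum_slot (h : ℤ) (C : MConfig) (mN mP : MCell → ℤ) (m : Fin 4 → Fin 4) :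
    moment h C mN mP m = ∑ x : Fin 4 → Fin 2, slotA h m x * C.wch mN mP (slotWord m x) := by
  simp only [moment, mono_eq_sum_slot, MConfig.wch, Pi.sub_apply, Finset.sum_apply, Pi.smul_apply]
  simp only [zsmul_eq_mul, Finset.mul_sum, mul_sub, Finset.sum_sub_distrib]
  congr 1
  · rw [Finset.sum_comm]
    exact Finset.sum_congr rfl fun _ _ => Finset.sum_congr rfl fun _ _ => by ring
  · rw [Finset.sum_comm]
    exact Finset.sum_congr rfl fun _ _ => Finset.sum_congr rfl fun _ _ => by ring

/-- a `β`/`β̄` letter of `m` makes every slot word e-mixed. -/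
theorem slotWord_not_eFree {m : Fin 4 → Fin 4} {f : Fin 4} (hf : m f = 2 ∨ m f = 3) (x : Fin 4 → Fin 2) :
    ¬ EFree (slotWord m x) := by
  intro hE
  have hEf : slotLetter (m f) (x f) ≠ 3 ∧ slotLetter (m f) (x f) ≠ 4 := hE f
  rcases hf with e | e
  · have h3 : ∀ j : Fin 2, slotLetter 2 j = 3 := by decide
    rw [e] at hEf
    exact hEf.1 (h3 _)
  · have h4 : ∀ j : Fin 2, slotLetter 3 j = 4 := by decide
    rw [e] at hEf
    exact hEf.2 (h4 _)

/-- only `ββββ` has the slot word `eeee`. -/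
theorem slotWord_ne_eWord {m : Fin 4 → Fin 4} (hb : m ≠ fun _ => 2) (x : Fin 4 → Fin 2) :
    slotWord m x ≠ eWord := by
  intro hx
  apply hb
  funext f
  have e : slotLetter (m f) (x f) = eWord f := congrFun hx f
  have h3 : ∀ g : Fin 4, eWord g = 3 := by decide
  have key : ∀ (l : Fin 4) (j : Fin 2), slotLetter l j = 3 → l = 2 := by decide
  exact key _ _ (e.trans (h3 f))

/-- only `β̄β̄β̄β̄` has the slot word `ēēēē`. -/
theorem slotWord_ne_ebarWord {m : Fin 4 → Fin 4} (hbb : m ≠ fun _ => 3) (x : Fin 4 → Fin 2) :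
    slotWord m x ≠ ebarWord := by
  intro hx
  apply hbb
  funext f
  have e : slotLetter (m f) (x f) = ebarWord f := congrFun hx f
  have h4 : ∀ g : Fin 4, ebarWord g = 4 := by decide
  have key : ∀ (l : Fin 4) (j : Fin 2), slotLetter l j = 4 → l = 3 := by decide
  exact key _ _ (e.trans (h4 f))

/-- **β-WORDS** (most of (M), and more: non-top words too): under (A1)(i) every moment word with a `β` or `β̄` letter,
other than `ββββ` and `β̄β̄β̄β̄`, has vanishing design moment — for EVERY configuration (no line hypothesis: the identity
`c = h·[1] − [u]` is the definition of the charge). -/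
theorem moment_eq_zero_of_beta (h : ℤ) (C : MConfig) (mN mP : MCell → ℤ) (hA1 : ClassScreen (C.wch mN mP))
    (m : Fin 4 → Fin 4) {f : Fin 4} (hf : m f = 2 ∨ m f = 3) (hb : m ≠ fun _ => 2) (hbb : m ≠ fun _ => 3) :
    moment h C mN mP m = 0 := by
  rw [moment_eq_sum_slot]
  refine Finset.sum_eq_zero fun x _ => ?_
  rw [hA1.1 _ (slotWord_not_eFree hf x) (slotWord_ne_eWord hb x) (slotWord_ne_ebarWord hbb x), mul_zero]

/-- LEMMA Ψ-LINE in charge form (local; cf. `Pad4TowerPsiLine.MCell.psi12_ceiling`): on a LINE cell every pair term of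
`12Ψ` is `2 c_f c_g` (`|β_f|² = c_f²`, `α_f − α_g = c_g − c_f`), so `12Ψ(Z) = 12·Π_f c_f`. -/
theorem psi12_of_lineCell {h : ℤ} {Z : MCell} (hZ : LineCell h Z) : Z.psi12 = 12 * ∏ f, lineCharge h Z f := by
  have hα : ∀ f, (Z f).1 = h - lineCharge h Z f := fun f => by simp [lineCharge]
  have hs : ∀ f, (Z f).2.1 ^ 2 + (Z f).2.2 ^ 2 = lineCharge h Z f ^ 2 := fun f => by
    obtain ⟨c, k, e⟩ := hZ f
    rw [lineCharge_of_eq e, e]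
    fin_cases k <;> simp [lineLetter]
  simp only [MCell.psi12, psiTwelve, hs, hα, Fin.prod_univ_four]
  ring

/-- **`cccc`**: on a LINE configuration passing (A1) the charge-product moment vanishes — `12·N(cccc) = Λ₁₂(wch) = 0`
(the Ψ-row `MConfig.psiRow_of_classScreen` read through LEMMA Ψ-LINE). -/
theorem moment_cccc_eq_zero (h : ℤ) (C : MConfig) (mN mP : MCell → ℤ)
    (hline : ∀ Z ∈ C.lower ∪ C.upper, LineCell h Z) (hA1 : ClassScreen (C.wch mN mP)) :
    moment h C mN mP (fun _ => 1) = 0 := by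
  have h0 := lamTwelve_eq_zero_of_classScreen _ hA1
  simp only [MConfig.wch, map_sub, map_sum, map_zsmul, MCell.lamTwelve_ch] at h0
  have hL : ∀ Z ∈ C.lower, ((Z.psi12 : ℤ) : GaussianInt) = 12 * MCell.mono h Z (fun _ => 1) := fun Z hZ => by
    rw [psi12_of_lineCell (hline Z (Finset.mem_union_left _ hZ)), mono_one]
    push_cast
    ring
  have hU : ∀ P ∈ C.upper, ((P.psi12 : ℤ) : GaussianInt) = 12 * MCell.mono h P (fun _ => 1) := fun P hP => by
    rw [psi12_of_lineCell (hline P (Finset.mem_union_right _ hP)), mono_one]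
    push_cast
    ring
  have h1 : ∑ Z ∈ C.lower, mN Z • ((12 : GaussianInt) * MCell.mono h Z (fun _ => 1)) -
      ∑ P ∈ C.upper, mP P • ((12 : GaussianInt) * MCell.mono h P (fun _ => 1)) = 0 := by
    rw [← h0]
    congr 1
    · exact Finset.sum_congr rfl fun Z hZ => by rw [hL Z hZ]
    · exact Finset.sum_congr rfl fun P hP => by rw [hU P hP]
  have h12 : (12 : GaussianInt) * moment h C mN mP (fun _ => 1) = 0 := by
    rw [← h1, moment, mul_sub, Finset.mul_sum, Finset.mul_sum]
    simp only [mul_smul_comm]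
  exact (mul_eq_zero.mp h12).resolve_left (by decide)

/-! ## §1c glue to the census vocabulary: LINE cells = axis letters on the ceiling line `α + c = h` (control g5)
(`OnCeiling`, `absCharge` of `Pad4TowerDiamondMu4`; `AxisPt`, `chargeOf` of the FC-core seams; so `CeilingLine.LineSupport h C`
together with the axis clause of `MConfig.InDiamond` says exactly that every cell of `C` is a `LineCell h`.) -/

theorem axis_ceiling_of_lineLetter (h : ℤ) (c : ℕ) (k : Fin 4) :
    ((lineLetter h c k).2 = (0, 0) ∨ AxisPt (lineLetter h c k)) ∧ OnCeiling h (lineLetter h c k) := by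
  rcases Nat.eq_zero_or_pos c with rfl | hc
  · refine ⟨Or.inl ?_, ?_⟩ <;> simp [lineLetter, OnCeiling, absCharge, chargeOf]
  · have hc' : (0 : ℤ) < c := by exact_mod_cast hc
    fin_cases k <;>
      simp [lineLetter, OnCeiling, absCharge, chargeOf, AxisPt, abs_of_pos hc'] <;>
      exact Or.inr (Nat.pos_iff_ne_zero.mp hc)

theorem lineLetter_of_axis_ceiling (h : ℤ) (x : BPoint) (hax : x.2 = (0, 0) ∨ AxisPt x) (hc : OnCeiling h x) :
    ∃ c : ℕ, ∃ k : Fin 4, x = lineLetter h c k := by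
  obtain ⟨a, re, im⟩ := x
  simp only [OnCeiling, absCharge, chargeOf] at hc
  simp only [AxisPt, Prod.mk.injEq] at hax
  rcases hax with ⟨hre, him⟩ | ⟨hre, him⟩ | ⟨hre, him⟩
  · subst hre; subst him
    refine ⟨0, 0, ?_⟩
    simp at hc
    simp [lineLetter, hc.symm]
  · subst him
    rcases lt_or_gt_of_ne hre with hlt | hgt
    · refine ⟨(-re).natAbs, 2, ?_⟩
      have ha : a = h - (-re) := by rw [abs_of_neg (by linarith : re - 0 < 0)] at hc; linarith
      simp [lineLetter, ha, abs_of_neg hlt]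
    · refine ⟨re.natAbs, 0, ?_⟩
      have e : ((re.natAbs : ℕ) : ℤ) = re := Int.natAbs_of_nonneg hgt.le
      have ha : a = h - re := by rw [abs_of_pos (by linarith : (0:ℤ) < re - 0)] at hc; linarith
      simp [lineLetter, e, ha]
  · subst hre
    rcases lt_or_gt_of_ne him with hlt | hgt
    · refine ⟨(-im).natAbs, 1, ?_⟩
      have ha : a = h - (-im) := by rw [abs_of_pos (by linarith : (0:ℤ) < 0 - im)] at hc; linarith
      simp [lineLetter, ha, abs_of_neg hlt]
    · refine ⟨im.natAbs, 3, ?_⟩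
      have e : ((im.natAbs : ℕ) : ℤ) = im := Int.natAbs_of_nonneg hgt.le
      have ha : a = h - im := by rw [abs_of_neg (by linarith : 0 - im < 0)] at hc; linarith
      simp [lineLetter, e, ha]

/-- **LINE cells are exactly the cells of axis letters on the ceiling line.** -/
theorem lineCell_iff_axis_ceiling (h : ℤ) (Z : MCell) :
    LineCell h Z ↔ ∀ f, ((Z f).2 = (0, 0) ∨ AxisPt (Z f)) ∧ OnCeiling h (Z f) := by
  constructor
  · intro hZ f
    obtain ⟨c, k, e⟩ := hZ f
    rw [e]; exact axis_ceiling_of_lineLetter h c k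
  · intro hZ f
    exact lineLetter_of_axis_ceiling h (Z f) (hZ f).1 (hZ f).2

/-- the census form: a configuration with axis letters (`MConfig.InDiamond`'s first clause) and LINE SUPPORT of height `h`
(`CeilingLine.LineSupport h C`, unfolded) consists of `LineCell h` cells. -/
theorem lineCells_of_axis_lineSupport (h : ℤ) (C : MConfig)
    (hax : ∀ Z ∈ C.lower ∪ C.upper, ∀ f, (Z f).2 = (0, 0) ∨ AxisPt (Z f))
    (hsup : (∀ Z ∈ C.lower, ∀ f, OnCeiling h (Z f)) ∧ ∀ P ∈ C.upper, ∀ f, OnCeiling h (P f)) :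
    ∀ Z ∈ C.lower ∪ C.upper, LineCell h Z := by
  intro Z hZ
  refine (lineCell_iff_axis_ceiling h Z).2 fun f => ⟨hax Z hZ f, ?_⟩
  rcases Finset.mem_union.1 hZ with hl | hu
  · exact hsup.1 Z hl f
  · exact hsup.2 Z hu f

/-! ## §2 (M): on the line, (A1) kills every top mixed moment except `ββββ`, `β̄β̄β̄β̄` -/

/-- `μ` is the `ββββ` moment: the `eeee`-coefficient of the weighted class tensor (cf. `Design.ch_eWord`; e-slot `= β`). -/
theorem wch_eWord_eq_moment_beta (h : ℤ) (C : MConfig) (mN mP : MCell → ℤ) :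
    C.wch mN mP eWord = moment h C mN mP (fun _ => 2) := by
  simp only [MConfig.wch, moment, Pi.sub_apply, Finset.sum_apply, Pi.smul_apply, ch_eWord, mono_two]

/-- **(M)** (the direction used by the law): LINE + (A1) ⇒ all top mixed moments vanish except `ββββ`, `β̄β̄β̄β̄`.
(Pen: `e^{−hH}·ch` has no `p`-letter on the line, and `H^k`, `k ≥ 2`, have independent non-zero `p`-parts; kernel route:
triangular elimination in powers of `h` from the (A1) rows of the e-mixed words, induction on the number of `u`-letters.) -/
theorem topMoment_eq_zero_of_classScreen (h : ℤ) (C : MConfig) (mN mP : MCell → ℤ)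
    (hline : ∀ Z ∈ C.lower ∪ C.upper, LineCell h Z) (hA1 : ClassScreen (C.wch mN mP))
    (w : Fin 4 → Fin 4) (hw : TopWord w) (hb : w ≠ fun _ => 2) (hbb : w ≠ fun _ => 3) :
    moment h C mN mP w = 0 := by
  by_cases hc : w = fun _ => 1
  · -- the `cccc` row: the Ψ-row on the line
    subst hc
    exact moment_cccc_eq_zero h C mN mP hline hA1
  · -- otherwise some letter is `β` or `β̄`: a β-word, killed term by term by (A1)(i)
    have hβ : ∃ f, w f = 2 ∨ w f = 3 := by
      by_contra hne
      push Not at hne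
      apply hc
      funext f
      have key : ∀ l : Fin 4, l ≠ 0 → l ≠ 2 → l ≠ 3 → l = 1 := by decide
      exact key _ (hw f) (hne f).1 (hne f).2
    obtain ⟨f, hf⟩ := hβ
    exact moment_eq_zero_of_beta h C mN mP hA1 w hf hb hbb

/-! ## §3 flows (König–Egerváry form of the generic-rank condition) -/

/-- a P-SATURATING UP FLOW: `π P N` units from the `P`-cell `P` to the `N`-cell `N` along live pairs `P ≤ N`,
every `P`-cell fully matched, `N`-capacities respected (cokernel presentation `⊕P → ⊕N → 𝓔 → 0` of generic rank `Σ m_P`). -/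
structure UpFlow (C : MConfig) (mN mP : MCell → ℤ) where
  /-- flow value on the ordered pair (P-cell, N-cell) -/
  π : MCell → MCell → ℕ
  live : ∀ P N, π P N ≠ 0 → P ∈ C.upper ∧ N ∈ C.lower ∧ MCell.le P N
  sat : ∀ P ∈ C.upper, (∑ N ∈ C.lower, (π P N : ℤ)) = mP P
  cap : ∀ N ∈ C.lower, (∑ P ∈ C.upper, (π P N : ℤ)) ≤ mN N

/-- a P-SATURATING DOWN FLOW: pairs `N ≤ P` (kernel presentation `0 → 𝓔 → ⊕N → ⊕P`, `⊕N → ⊕P` of generic rank `Σ m_P`). -/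
structure DownFlow (C : MConfig) (mN mP : MCell → ℤ) where
  /-- flow value on the ordered pair (N-cell, P-cell) -/
  π : MCell → MCell → ℕ
  live : ∀ N P, π N P ≠ 0 → N ∈ C.lower ∧ P ∈ C.upper ∧ MCell.le N P
  sat : ∀ P ∈ C.upper, (∑ N ∈ C.lower, (π N P : ℤ)) = mP P
  cap : ∀ N ∈ C.lower, (∑ P ∈ C.upper, (π N P : ℤ)) ≤ mN N

/-- the residual multiplicity of an `N`-cell under an up flow. -/
def UpFlow.residual {C : MConfig} {mN mP : MCell → ℤ} (F : UpFlow C mN mP) (N : MCell) : ℤ :=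
  mN N - ∑ P ∈ C.upper, (F.π P N : ℤ)

/-! ## §4 the law at design level -/

/-- **DOWN (kernel orientation), every rank**: a LINE configuration passing (A1) with a P-saturating down flow has `μ = 0`
(transport weights `W ≥ 0`, `Σ W = N(cccc) = 0`). -/
theorem lineTwoTermDown_mu_eq_zero (h : ℤ) (C : MConfig) (mN mP : MCell → ℤ)
    (_hmN : ∀ Z, 0 ≤ mN Z) (_hmP : ∀ P, 0 ≤ mP P)
    (hline : ∀ Z ∈ C.lower ∪ C.upper, LineCell h Z) (hA1 : ClassScreen (C.wch mN mP))
    (F : DownFlow C mN mP) : C.wch mN mP eWord = 0 := by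
  classical
  have hL : ∀ Z ∈ C.lower, LineCell h Z := fun Z hZ => hline Z (Finset.mem_union_left _ hZ)
  have hU : ∀ P ∈ C.upper, LineCell h P := fun P hP => hline P (Finset.mem_union_right _ hP)
  set v : MCell → ℤ := fun Z => ∏ f, lineCharge h Z f with hv
  set b : MCell → GaussianInt := fun Z => ∏ f, betaG Z f with hb
  set r : MCell → ℤ := fun Z => mN Z - ∑ P ∈ C.upper, (F.π Z P : ℤ) with hr
  have hr0 : ∀ Z ∈ C.lower, 0 ≤ r Z := fun Z hZ => sub_nonneg.mpr (F.cap Z hZ)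
  -- (1) the `cccc` moment vanishes (the one instance of (M) used), as an integer identity
  have hM : (∑ Z ∈ C.lower, mN Z * v Z) - ∑ P ∈ C.upper, mP P * v P = 0 := by
    have h0 := topMoment_eq_zero_of_classScreen h C mN mP hline hA1 (fun _ => 1)
      (by unfold TopWord; decide) (by decide) (by decide)
    simp only [moment, mono_one, zsmul_eq_mul] at h0
    exact_mod_cast h0
  -- (2) flow decomposition of any weighted difference
  have hdec : ∀ {R : Type} [CommRing R] (g : MCell → R),
      (∑ Z ∈ C.lower, (mN Z : R) * g Z) - ∑ P ∈ C.upper, (mP P : R) * g P =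
        ∑ Z ∈ C.lower, ((r Z : R) * g Z + ∑ P ∈ C.upper, (F.π Z P : R) * (g Z - g P)) := by
    intro R _ g
    have hs : ∑ P ∈ C.upper, (mP P : R) * g P = ∑ P ∈ C.upper, ∑ Z ∈ C.lower, (F.π Z P : R) * g P := by
      refine Finset.sum_congr rfl fun P hP => ?_
      rw [← Finset.sum_mul]
      congr 1
      have := F.sat P hP
      rw [← this]; push_cast; rfl
    have hpt : ∀ Z, (r Z : R) * g Z + ∑ P ∈ C.upper, (F.π Z P : R) * (g Z - g P) =
        (mN Z : R) * g Z - ∑ P ∈ C.upper, (F.π Z P : R) * g P := by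
      intro Z
      simp only [hr, mul_sub, Finset.sum_sub_distrib, ← Finset.sum_mul]
      push_cast
      ring
    rw [Finset.sum_congr rfl fun Z _ => hpt Z, Finset.sum_sub_distrib, hs, Finset.sum_comm]
  -- (3) every transport weight is ≥ 0 and they sum to `N(cccc) = 0`: termwise vanishing
  have hpair : ∀ Z ∈ C.lower, ∀ P ∈ C.upper, 0 ≤ (F.π Z P : ℤ) * (v Z - v P) := by
    intro Z hZ P hP
    by_cases h0 : F.π Z P = 0
    · simp [h0]
    · obtain ⟨-, -, hle⟩ := F.live Z P h0
      exact mul_nonneg (by exact_mod_cast Nat.zero_le _) (sub_nonneg.mpr (v_le (hL Z hZ) (hU P hP) hle))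
  have hsum : ∑ Z ∈ C.lower, (r Z * v Z + ∑ P ∈ C.upper, (F.π Z P : ℤ) * (v Z - v P)) = 0 := by
    have := hdec (R := ℤ) v
    push_cast at this
    rw [← this]; exact hM
  have hZ0 := (Finset.sum_eq_zero_iff_of_nonneg fun Z hZ =>
    add_nonneg (mul_nonneg (hr0 Z hZ) (v_nonneg (hL Z hZ))) (Finset.sum_nonneg (hpair Z hZ))).mp hsum
  have hres : ∀ Z ∈ C.lower, r Z * v Z = 0 ∧ ∀ P ∈ C.upper, (F.π Z P : ℤ) * (v Z - v P) = 0 := by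
    intro Z hZ
    have e := hZ0 Z hZ
    have a0 : 0 ≤ r Z * v Z := mul_nonneg (hr0 Z hZ) (v_nonneg (hL Z hZ))
    have b0 : 0 ≤ ∑ P ∈ C.upper, (F.π Z P : ℤ) * (v Z - v P) := Finset.sum_nonneg (hpair Z hZ)
    have a1 : r Z * v Z = 0 := by linarith
    refine ⟨a1, ?_⟩
    have b1 : ∑ P ∈ C.upper, (F.π Z P : ℤ) * (v Z - v P) = 0 := by linarith
    exact (Finset.sum_eq_zero_iff_of_nonneg (hpair Z hZ)).mp b1
  -- (4) the same decomposition for `μ = N(ββββ)`; every term dies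
  rw [wch_eWord_eq_moment_beta h]
  have hgoal : (∑ Z ∈ C.lower, (mN Z : GaussianInt) * b Z) - ∑ P ∈ C.upper, (mP P : GaussianInt) * b P = 0 := by
    rw [hdec (R := GaussianInt) b]
    refine Finset.sum_eq_zero fun Z hZ => ?_
    obtain ⟨h1, h2⟩ := hres Z hZ
    have t1 : (r Z : GaussianInt) * b Z = 0 := by
      rcases mul_eq_zero.mp h1 with h | h
      · simp [h]
      · rw [hb]; simp only; rw [b_eq_zero_of_v (hL Z hZ) h, mul_zero]
    have t2 : ∑ P ∈ C.upper, (F.π Z P : GaussianInt) * (b Z - b P) = 0 := by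
      refine Finset.sum_eq_zero fun P hP => ?_
      by_cases h0 : F.π Z P = 0
      · simp [h0]
      · obtain ⟨-, -, hle⟩ := F.live Z P h0
        have e := h2 P hP
        rcases mul_eq_zero.mp e with h | h
        · exact absurd (by exact_mod_cast h) h0
        · have : b P = b Z := b_eq_of_v_eq (hL Z hZ) (hU P hP) hle (by linarith)
          rw [this, sub_self, mul_zero]
    rw [t1, t2, add_zero]
  simpa [moment, mono_two, zsmul_eq_mul, hb] using hgoal

/-! ## §4b UP orientation — transport to the phase torus (s4-prove-1 g32, K3c helpers) -/

/-- `e s = i^s` on `ℤ/4` (local copy; the tree copy lives in `Summits/Ventures/HSemireg/PhaseTorusLaw.lean`). -/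
noncomputable def upE (s : ZMod 4) : ℂ := Complex.I ^ s.val

theorem upE_zero : upE 0 = 1 := by simp [upE]

theorem upE_add (x y : ZMod 4) : upE (x + y) = upE x * upE y := by
  unfold upE
  rw [← pow_add, ZMod.val_add]
  conv_rhs => rw [← Nat.div_add_mod (x.val + y.val) 4, pow_add, pow_mul, Complex.I_pow_four, one_pow, one_mul]

theorem upE_sum (s : Fin 4 → ZMod 4) : upE (∑ f, s f) = ∏ f, upE (s f) := by
  rw [Fin.sum_univ_four, Fin.prod_univ_four, upE_add, upE_add, upE_add]

theorem norm_upE (x : ZMod 4) : ‖upE x‖ = 1 := by simp [upE, Complex.norm_I]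

theorem upE_ne_zero (x : ZMod 4) : upE x ≠ 0 := fun h => by
  have := norm_upE x; rw [h, norm_zero] at this; exact zero_ne_one this

theorem upE_neg (x : ZMod 4) : upE (-x) = (starRingEnd ℂ) (upE x) := by
  have h1 : upE (-x) * upE x = 1 := by rw [← upE_add, neg_add_cancel, upE_zero]
  have h2 : (starRingEnd ℂ) (upE x) * upE x = 1 := by
    rw [mul_comm, Complex.mul_conj, Complex.normSq_eq_norm_sq, norm_upE]; norm_num
  exact mul_right_cancel₀ (upE_ne_zero x) (h1.trans h2.symm)

theorem upE_three_mul_neg (x : ZMod 4) : upE (3 * x) = (starRingEnd ℂ) (upE x) := by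
  rw [show (3 : ZMod 4) = -1 from by decide, neg_one_mul, upE_neg]

/-- phase index of a factor point off the apex (`0` at the apex, where it is immaterial). -/
def phaseOf (p : BPoint) : Fin 4 :=
  if 0 < p.2.1 then 0 else if p.2.2 < 0 then 1 else if p.2.1 < 0 then 2 else if 0 < p.2.2 then 3 else 0

theorem phaseOf_lineLetter (h : ℤ) {c : ℕ} (hc : 0 < c) (k : Fin 4) : phaseOf (lineLetter h c k) = k := by
  have hc' : (0 : ℤ) < c := by exact_mod_cast hc
  have hc0 : c ≠ 0 := hc.ne'
  fin_cases k <;> simp [phaseOf, lineLetter, hc0, not_lt.mpr hc'.le]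

/-- the torus coordinate of a cell: `τ_f = −k_f` (so that the character `(1,1,1,1)` reads the `ββββ` moment). -/
def tau (Z : MCell) : Fin 4 → ZMod 4 := fun f => -(((phaseOf (Z f)).val : ℕ) : ZMod 4)

/-- the negated phase exponents `−k` for `k = 0,1,2,3` have `val` `0,3,2,1`. -/
theorem neg_val_table (k : Fin 4) : (-(((k.val : ℕ)) : ZMod 4)).val = ![0, 3, 2, 1] k := by
  fin_cases k <;> decide

/-- `conj(i^k)` as a complex number is `i^{−k}`. -/
theorem toComplex_unitG (k : Fin 4) : ((unitG k : GaussianInt) : ℂ) = upE (-((k.val : ℕ) : ZMod 4)) := by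
  rw [upE, neg_val_table]
  fin_cases k <;> simp [unitG, GaussianInt.toComplex_def₂, Complex.ext_iff, pow_succ, Complex.I_mul_I]

/-- `β_f` in `ℂ` is `c_f · e(τ_f)`. -/
theorem toComplex_betaG {h : ℤ} {Z : MCell} (hZ : LineCell h Z) (f : Fin 4) :
    ((betaG Z f : GaussianInt) : ℂ) = (lineCharge h Z f : ℂ) * upE (tau Z f) := by
  obtain ⟨c, k, e⟩ := hZ f
  rw [betaG_of_eq e, lineCharge_of_eq e, map_mul, map_natCast, toComplex_unitG]
  push_cast
  rcases Nat.eq_zero_or_pos c with h0 | hpos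
  · simp [h0]
  · congr 1
    simp only [tau, e, phaseOf_lineLetter h hpos k]

/-- `β̄_f` in `ℂ` is `c_f · e(3 τ_f)`. -/
theorem toComplex_star_betaG {h : ℤ} {Z : MCell} (hZ : LineCell h Z) (f : Fin 4) :
    ((star (betaG Z f) : GaussianInt) : ℂ) = (lineCharge h Z f : ℂ) * upE (3 * tau Z f) := by
  rw [GaussianInt.toComplex_star, toComplex_betaG hZ f, map_mul, map_intCast, upE_three_mul_neg]

/-- the moment word read by the character `k` (entries `0,1,3 ↦ c, β, β̄`; `2 ↦` unit, never used). -/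
def wordOf (k : Fin 4 → ZMod 4) : Fin 4 → Fin 4 :=
  fun f => if k f = 0 then 1 else if k f = 1 then 2 else if k f = 3 then 3 else 0

theorem z4_facts : (1 : ZMod 4) ≠ 0 ∧ (2 : ZMod 4) ≠ 0 ∧ (2 : ZMod 4) ≠ 1 ∧ (2 : ZMod 4) ≠ 3 ∧
    (3 : ZMod 4) ≠ 0 ∧ (3 : ZMod 4) ≠ 1 := by decide

theorem wordOf_apply_zero {k : Fin 4 → ZMod 4} {f : Fin 4} (h : k f = 0) : wordOf k f = 1 := by simp [wordOf, h]
theorem wordOf_apply_one {k : Fin 4 → ZMod 4} {f : Fin 4} (h : k f = 1) : wordOf k f = 2 := by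
  simp [wordOf, h, z4_facts.1]
theorem wordOf_apply_three {k : Fin 4 → ZMod 4} {f : Fin 4} (h : k f = 3) : wordOf k f = 3 := by
  simp [wordOf, h, z4_facts.2.2.2.2.1, z4_facts.2.2.2.2.2]

theorem wordOf_one : wordOf (fun _ => (1 : ZMod 4)) = fun _ => 2 := by
  funext f; exact wordOf_apply_one rfl

theorem wordOf_top {k : Fin 4 → ZMod 4} (hk : ∀ f, k f ≠ 2) : TopWord (wordOf k) := by
  intro f
  have h4 : ∀ y : ZMod 4, y = 0 ∨ y = 1 ∨ y = 2 ∨ y = 3 := by decide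
  rcases h4 (k f) with h | h | h | h
  · rw [wordOf_apply_zero h]; decide
  · rw [wordOf_apply_one h]; decide
  · exact absurd h (hk f)
  · rw [wordOf_apply_three h]; decide

theorem wordOf_ne {k : Fin 4 → ZMod 4} (hk2 : ∀ f, k f ≠ 2) {j : ZMod 4} {m : Fin 4} (hj : j = 1 ∧ m = 2 ∨ j = 3 ∧ m = 3)
    (hk : k ≠ fun _ => j) : wordOf k ≠ fun _ => m := by
  intro h
  apply hk
  funext f
  have hf := congr_fun h f
  have h4 : ∀ y : ZMod 4, y = 0 ∨ y = 1 ∨ y = 2 ∨ y = 3 := by decide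
  rcases h4 (k f) with e | e | e | e
  · rw [wordOf_apply_zero e] at hf; rcases hj with ⟨-, rfl⟩ | ⟨-, rfl⟩ <;> exact absurd hf (by decide)
  · rw [wordOf_apply_one e] at hf; rcases hj with ⟨rfl, -⟩ | ⟨-, rfl⟩
    · exact e
    · exact absurd hf (by decide)
  · exact absurd e (hk2 f)
  · rw [wordOf_apply_three e] at hf; rcases hj with ⟨-, rfl⟩ | ⟨rfl, -⟩
    · exact absurd hf (by decide)
    · exact e

/-- per factor: the moment letter read by `k_f ∈ {0,1,3}` is `c_f · e(k_f τ_f)` in `ℂ`. -/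
theorem toComplex_mletter_wordOf {h : ℤ} {Z : MCell} (hZ : LineCell h Z) (k : Fin 4 → ZMod 4) (f : Fin 4)
    (hk : k f ≠ 2) :
    ((mletter h Z f (wordOf k f) : GaussianInt) : ℂ) = (lineCharge h Z f : ℂ) * upE (k f * tau Z f) := by
  have h4 : ∀ y : ZMod 4, y = 0 ∨ y = 1 ∨ y = 2 ∨ y = 3 := by decide
  rcases h4 (k f) with e | e | e | e
  · rw [wordOf_apply_zero e, e, zero_mul, upE_zero, mul_one]
    simp [mletter]
  · rw [wordOf_apply_one e, e, one_mul]
    simp only [mletter, Matrix.cons_val_two, Matrix.tail_cons, Matrix.head_cons]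
    exact toComplex_betaG hZ f
  · exact absurd e hk
  · rw [wordOf_apply_three e, e]
    simp only [mletter, Matrix.cons_val_three, Matrix.tail_cons, Matrix.head_cons]
    exact toComplex_star_betaG hZ f

/-- the monomial of a cell at the word read by `k` is `V(Z) · χ_k(τ(Z))` in `ℂ`. -/
theorem toComplex_mono_wordOf {h : ℤ} {Z : MCell} (hZ : LineCell h Z) (k : Fin 4 → ZMod 4) (hk : ∀ f, k f ≠ 2) :
    ((MCell.mono h Z (wordOf k) : GaussianInt) : ℂ) =
      ((∏ f, lineCharge h Z f : ℤ) : ℂ) * Complex.I ^ (∑ f, k f * tau Z f).val := by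
  unfold MCell.mono
  rw [map_prod, Finset.prod_congr rfl fun f _ => toComplex_mletter_wordOf hZ k f (hk f), Finset.prod_mul_distrib]
  push_cast
  congr 1
  exact (upE_sum _).symm

/-- phases agree along a live pair off the apex locus: `P ≤ N`, `V(N) ≠ 0 ⇒ τ(N) = τ(P)`. -/
theorem tau_eq_of_le {h : ℤ} {P N : MCell} (hP : LineCell h P) (hN : LineCell h N) (hle : MCell.le P N)
    (hv : ∏ f, lineCharge h N f ≠ 0) : tau N = tau P := by
  funext f
  obtain ⟨c, k, e⟩ := hP f
  obtain ⟨c', k', e'⟩ := hN f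
  have he : Effective (bsub (lineLetter h c' k') (lineLetter h c k)) := by
    have := hle f; rwa [e, e'] at this
  obtain ⟨hcc, hk⟩ := slide_letter h he
  have hc' : c' ≠ 0 := by
    intro h0
    apply hv
    apply Finset.prod_eq_zero (Finset.mem_univ f)
    rw [lineCharge_of_eq e', h0]; rfl
  have hpos' : 0 < c' := Nat.pos_of_ne_zero hc'
  have hpos : 0 < c := lt_of_lt_of_le hpos' hcc
  rcases hk with h0 | hkk
  · exact absurd h0 hc'
  · subst hkk
    simp only [tau, e, e', phaseOf_lineLetter h hpos, phaseOf_lineLetter h hpos']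


/-- **§4b′ the UP law for a general residual bound `γ`** (body = s4-prove-1 g32's K3c proof of memo §2 (T)+(ω)+(P), with the
literal corank bound `4` replaced by `γ`; control g5): given the torus-form law for positive sets of size `≤ γ`, an integer clean
LINE design with a two-term cokernel presentation of corank `≤ γ` carries no Weil moment. -/
theorem lineTwoTermUp_mu_eq_zero_of_law (γ : ℕ)
    (hPT : ∀ (ω : (Fin 4 → ZMod 4) → ℝ) (A : Finset (Fin 4 → ZMod 4)), A.card ≤ γ →
      (∀ τ, τ ∉ A → ω τ ≤ 0) →
      (∀ k : Fin 4 → ZMod 4, ((∀ f, k f ≠ 2) ∧ k ≠ (fun _ => 1) ∧ k ≠ (fun _ => 3)) →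
        (∑ τ : Fin 4 → ZMod 4, (ω τ : ℂ) * Complex.I ^ (∑ f, k f * τ f).val) = 0) →
      (∑ τ : Fin 4 → ZMod 4, (ω τ : ℂ) * Complex.I ^ (∑ f, (1 : ZMod 4) * τ f).val) = 0)
    (h : ℤ) (C : MConfig) (mN mP : MCell → ℤ)
    (_hmN : ∀ Z, 0 ≤ mN Z) (_hmP : ∀ P, 0 ≤ mP P)
    (hline : ∀ Z ∈ C.lower ∪ C.upper, LineCell h Z) (hA1 : ClassScreen (C.wch mN mP))
    (F : UpFlow C mN mP) (hrank : (∑ Z ∈ C.lower, mN Z) - (∑ P ∈ C.upper, mP P) ≤ (γ : ℤ)) :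
    C.wch mN mP eWord = 0 := by
  classical
  have hL : ∀ Z ∈ C.lower, LineCell h Z := fun Z hZ => hline Z (Finset.mem_union_left _ hZ)
  have hU : ∀ P ∈ C.upper, LineCell h P := fun P hP => hline P (Finset.mem_union_right _ hP)
  set v : MCell → ℤ := fun Z => ∏ f, lineCharge h Z f with hv
  set r : MCell → ℤ := fun N => mN N - ∑ P ∈ C.upper, (F.π P N : ℤ) with hr
  have hr0 : ∀ N ∈ C.lower, 0 ≤ r N := fun N hN => sub_nonneg.mpr (F.cap N hN)
  -- (0) flow decomposition of any weighted difference (as in the DOWN proof, π transposed)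
  have hdec : ∀ {R : Type} [CommRing R] (g : MCell → R),
      (∑ Z ∈ C.lower, (mN Z : R) * g Z) - ∑ P ∈ C.upper, (mP P : R) * g P =
        ∑ N ∈ C.lower, ((r N : R) * g N + ∑ P ∈ C.upper, (F.π P N : R) * (g N - g P)) := by
    intro R _ g
    have hs : ∑ P ∈ C.upper, (mP P : R) * g P = ∑ P ∈ C.upper, ∑ N ∈ C.lower, (F.π P N : R) * g P := by
      refine Finset.sum_congr rfl fun P hP => ?_
      rw [← Finset.sum_mul]
      congr 1
      have := F.sat P hP
      rw [← this]; push_cast; rfl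
    have hpt : ∀ N, (r N : R) * g N + ∑ P ∈ C.upper, (F.π P N : R) * (g N - g P) =
        (mN N : R) * g N - ∑ P ∈ C.upper, (F.π P N : R) * g P := by
      intro N
      simp only [hr, mul_sub, Finset.sum_sub_distrib, ← Finset.sum_mul]
      push_cast
      ring
    rw [Finset.sum_congr rfl fun N _ => hpt N, Finset.sum_sub_distrib, hs, Finset.sum_comm]
  -- (1) total residual = corank ≤ γ
  have hsumr : ∑ N ∈ C.lower, r N = (∑ Z ∈ C.lower, mN Z) - ∑ P ∈ C.upper, mP P := by
    simp only [hr, Finset.sum_sub_distrib]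
    rw [Finset.sum_comm]
    congr 1
    exact Finset.sum_congr rfl fun P hP => F.sat P hP
  -- the torus data: residual phase measure ω and the positive set A
  set A : Finset (Fin 4 → ZMod 4) := (C.lower.filter fun N => 0 < r N).image tau with hA
  set ω : (Fin 4 → ZMod 4) → ℝ := fun τ =>
      (∑ N ∈ C.lower, if tau N = τ then ((r N * v N : ℤ) : ℝ) else 0) +
        ∑ P ∈ C.upper, if tau P = τ then ((∑ N ∈ C.lower, (F.π P N : ℤ) * (v N - v P) : ℤ) : ℝ) else 0 with hω
  -- (1') |A| ≤ γ
  have hcard : A.card ≤ γ := by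
    have h1 : (A.card : ℤ) ≤ ((C.lower.filter fun N => 0 < r N).card : ℤ) := by
      exact_mod_cast Finset.card_image_le
    have h2 : ((C.lower.filter fun N => 0 < r N).card : ℤ) ≤ ∑ N ∈ C.lower.filter (fun N => 0 < r N), r N := by
      rw [Finset.card_eq_sum_ones]; push_cast
      exact Finset.sum_le_sum fun N hN => by have := (Finset.mem_filter.mp hN).2; omega
    have h3 : ∑ N ∈ C.lower.filter (fun N => 0 < r N), r N ≤ ∑ N ∈ C.lower, r N :=
      Finset.sum_le_sum_of_subset_of_nonneg (Finset.filter_subset _ _) fun N hN _ => hr0 N hN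
    have : (A.card : ℤ) ≤ (γ : ℤ) := by linarith [hsumr]
    exact_mod_cast this
  -- (2) ω ≤ 0 off A
  have hneg : ∀ τ, τ ∉ A → ω τ ≤ 0 := by
    intro τ hτ
    have h1 : ∑ N ∈ C.lower, (if tau N = τ then ((r N * v N : ℤ) : ℝ) else 0) = 0 := by
      refine Finset.sum_eq_zero fun N hN => ?_
      by_cases ht : tau N = τ
      · rw [if_pos ht]
        have hrN : ¬ 0 < r N := fun hpos => hτ (by
          rw [hA]; exact Finset.mem_image.mpr ⟨N, Finset.mem_filter.mpr ⟨hN, hpos⟩, ht⟩)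
        have : r N = 0 := le_antisymm (not_lt.mp hrN) (hr0 N hN)
        rw [this, zero_mul]; push_cast; rfl
      · rw [if_neg ht]
    have h2 : ∑ P ∈ C.upper, (if tau P = τ then
        ((∑ N ∈ C.lower, (F.π P N : ℤ) * (v N - v P) : ℤ) : ℝ) else 0) ≤ 0 := by
      refine Finset.sum_nonpos fun P hP => ?_
      by_cases ht : tau P = τ
      · rw [if_pos ht]
        have : ∑ N ∈ C.lower, (F.π P N : ℤ) * (v N - v P) ≤ 0 := by
          refine Finset.sum_nonpos fun N hN => ?_
          by_cases h0 : F.π P N = 0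
          · simp [h0]
          · obtain ⟨-, -, hle⟩ := F.live P N h0
            exact mul_nonpos_iff.mpr (Or.inl ⟨by exact_mod_cast Nat.zero_le _,
              sub_nonpos.mpr (v_le (hU P hP) (hL N hN) hle)⟩)
        exact_mod_cast this
      · rw [if_neg ht]
    show (∑ N ∈ C.lower, if tau N = τ then ((r N * v N : ℤ) : ℝ) else 0) +
        ∑ P ∈ C.upper, (if tau P = τ then
          ((∑ N ∈ C.lower, (F.π P N : ℤ) * (v N - v P) : ℤ) : ℝ) else 0) ≤ 0
    rw [h1, zero_add]; exact h2
  -- (3) the moments of ω are the design moments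
  have hmom : ∀ k : Fin 4 → ZMod 4, (∀ f, k f ≠ 2) →
      (∑ τ : Fin 4 → ZMod 4, (ω τ : ℂ) * Complex.I ^ (∑ f, k f * τ f).val) =
        ((moment h C mN mP (wordOf k) : GaussianInt) : ℂ) := by
    intro k hk
    -- the character as a function of the cell
    set χ : (Fin 4 → ZMod 4) → ℂ := fun τ => Complex.I ^ (∑ f, k f * τ f).val with hχ
    -- left side: push the fibre sums through
    have hlhs : (∑ τ : Fin 4 → ZMod 4, (ω τ : ℂ) * χ τ) =
        ∑ N ∈ C.lower, ((r N * v N : ℤ) : ℂ) * χ (tau N) +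
          ∑ P ∈ C.upper, ((∑ N ∈ C.lower, (F.π P N : ℤ) * (v N - v P) : ℤ) : ℂ) * χ (tau P) := by
      have e1 : ∀ τ, (ω τ : ℂ) * χ τ =
          ∑ N ∈ C.lower, (if tau N = τ then ((r N * v N : ℤ) : ℂ) * χ τ else 0) +
            ∑ P ∈ C.upper, (if tau P = τ then
              ((∑ N ∈ C.lower, (F.π P N : ℤ) * (v N - v P) : ℤ) : ℂ) * χ τ else 0) := by
        intro τ
        rw [hω]; push_cast
        rw [add_mul, Finset.sum_mul, Finset.sum_mul]
        congr 1 <;> refine Finset.sum_congr rfl fun x _ => ?_ <;> split_ifs <;> simp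
      rw [Finset.sum_congr rfl fun τ _ => e1 τ, Finset.sum_add_distrib, Finset.sum_comm,
        Finset.sum_comm (s := Finset.univ) (t := C.upper)]
      congr 1 <;> refine Finset.sum_congr rfl fun x _ => ?_ <;> rw [Finset.sum_ite_eq] <;> simp
    -- right side: the design moment, decomposed along the flow
    have hg : ∀ Z, LineCell h Z → ((MCell.mono h Z (wordOf k) : GaussianInt) : ℂ) = (v Z : ℂ) * χ (tau Z) :=
      fun Z hZ => toComplex_mono_wordOf hZ k hk
    have hrhs : ((moment h C mN mP (wordOf k) : GaussianInt) : ℂ) =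
        (∑ Z ∈ C.lower, (mN Z : ℂ) * ((v Z : ℂ) * χ (tau Z))) -
          ∑ P ∈ C.upper, (mP P : ℂ) * ((v P : ℂ) * χ (tau P)) := by
      unfold moment
      rw [map_sub, map_sum, map_sum]
      congr 1
      · refine Finset.sum_congr rfl fun Z hZ => ?_
        rw [zsmul_eq_mul, map_mul, map_intCast, hg Z (hL Z hZ)]
      · refine Finset.sum_congr rfl fun P hP => ?_
        rw [zsmul_eq_mul, map_mul, map_intCast, hg P (hU P hP)]
    -- the transport step on each live pair
    have hpair : ∀ P ∈ C.upper, ∀ N ∈ C.lower,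
        (F.π P N : ℂ) * ((v N : ℂ) * χ (tau N) - (v P : ℂ) * χ (tau P)) =
          (F.π P N : ℂ) * ((v N : ℂ) - v P) * χ (tau P) := by
      intro P hP N hN
      by_cases h0 : F.π P N = 0
      · simp [h0]
      · obtain ⟨-, -, hle⟩ := F.live P N h0
        by_cases hvN : v N = 0
        · rw [hvN]; push_cast; ring
        · rw [tau_eq_of_le (hU P hP) (hL N hN) hle hvN]; ring
    rw [hlhs, hrhs, hdec (R := ℂ) (fun Z => (v Z : ℂ) * χ (tau Z)), Finset.sum_add_distrib]
    congr 1
    · refine Finset.sum_congr rfl fun N _ => ?_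
      push_cast; ring
    · rw [Finset.sum_comm]
      refine Finset.sum_congr rfl fun P hP => ?_
      push_cast
      rw [Finset.sum_mul]
      exact Finset.sum_congr rfl fun N hN => (hpair P hP N hN).symm
  -- (4) clean moments of ω vanish by (M); (5) the law kills ω̂(1,1,1,1) = μ
  have hclean : ∀ k : Fin 4 → ZMod 4, ((∀ f, k f ≠ 2) ∧ k ≠ (fun _ => 1) ∧ k ≠ (fun _ => 3)) →
      (∑ τ : Fin 4 → ZMod 4, (ω τ : ℂ) * Complex.I ^ (∑ f, k f * τ f).val) = 0 := by
    rintro k ⟨hk2, hk1, hk3⟩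
    rw [hmom k hk2, topMoment_eq_zero_of_classScreen h C mN mP hline hA1 (wordOf k) (wordOf_top hk2)
      (wordOf_ne hk2 (Or.inl ⟨rfl, rfl⟩) hk1) (wordOf_ne hk2 (Or.inr ⟨rfl, rfl⟩) hk3), map_zero]
  have htop := hPT ω A hcard hneg hclean
  rw [hmom (fun _ => 1) (fun _ => by decide), wordOf_one] at htop
  have hμ : moment h C mN mP (fun _ => 2) = 0 :=
    GaussianInt.toComplex_injective (by rw [htop, map_zero])
  rw [wch_eWord_eq_moment_beta h, hμ]

/-- **UP (cokernel orientation), rank ≤ 4**: a LINE configuration passing (A1) with a P-saturating up flow and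
`Σ m_N − Σ m_P ≤ 4` has `μ = 0`, GIVEN the finite phase-torus law `hPT` (verbatim `PhaseTorus.PhaseTorusLaw`; kernel target
of `PhaseTorusLaw-v3wip.lean`, to be imported from `Summits/Ventures/HSemireg/PhaseTorusLaw.lean` once landed). -/
theorem lineTwoTermUp_mu_eq_zero
    (hPT : ∀ (ω : (Fin 4 → ZMod 4) → ℝ) (A : Finset (Fin 4 → ZMod 4)), A.card ≤ 4 →
      (∀ τ, τ ∉ A → ω τ ≤ 0) →
      (∀ k : Fin 4 → ZMod 4, ((∀ f, k f ≠ 2) ∧ k ≠ (fun _ => 1) ∧ k ≠ (fun _ => 3)) →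
        (∑ τ : Fin 4 → ZMod 4, (ω τ : ℂ) * Complex.I ^ (∑ f, k f * τ f).val) = 0) →
      (∑ τ : Fin 4 → ZMod 4, (ω τ : ℂ) * Complex.I ^ (∑ f, (1 : ZMod 4) * τ f).val) = 0)
    (h : ℤ) (C : MConfig) (mN mP : MCell → ℤ)
    (_hmN : ∀ Z, 0 ≤ mN Z) (_hmP : ∀ P, 0 ≤ mP P)
    (hline : ∀ Z ∈ C.lower ∪ C.upper, LineCell h Z) (hA1 : ClassScreen (C.wch mN mP))
    (F : UpFlow C mN mP) (hrank : (∑ Z ∈ C.lower, mN Z) - (∑ P ∈ C.upper, mP P) ≤ 4) :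
    C.wch mN mP eWord = 0 :=
  lineTwoTermUp_mu_eq_zero_of_law 4 hPT h C mN mP _hmN _hmP hline hA1 F (by exact_mod_cast hrank)

/-- **§4c the UP law at corank ≤ 7** (control g5; PART E of `PhaseTorusLaw.lean` v4 = `phaseTorusLaw7_holds` discharges `hPT7`
verbatim): the same sentence with `4 ↦ 7` — the sharp range of the box certificate (memo §9 (C⁷)). -/
theorem lineTwoTermUp7_mu_eq_zero
    (hPT7 : ∀ (ω : (Fin 4 → ZMod 4) → ℝ) (A : Finset (Fin 4 → ZMod 4)), A.card ≤ 7 →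
      (∀ τ, τ ∉ A → ω τ ≤ 0) →
      (∀ k : Fin 4 → ZMod 4, ((∀ f, k f ≠ 2) ∧ k ≠ (fun _ => 1) ∧ k ≠ (fun _ => 3)) →
        (∑ τ : Fin 4 → ZMod 4, (ω τ : ℂ) * Complex.I ^ (∑ f, k f * τ f).val) = 0) →
      (∑ τ : Fin 4 → ZMod 4, (ω τ : ℂ) * Complex.I ^ (∑ f, (1 : ZMod 4) * τ f).val) = 0)
    (h : ℤ) (C : MConfig) (mN mP : MCell → ℤ)
    (_hmN : ∀ Z, 0 ≤ mN Z) (_hmP : ∀ P, 0 ≤ mP P)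
    (hline : ∀ Z ∈ C.lower ∪ C.upper, LineCell h Z) (hA1 : ClassScreen (C.wch mN mP))
    (F : UpFlow C mN mP) (hrank : (∑ Z ∈ C.lower, mN Z) - (∑ P ∈ C.upper, mP P) ≤ 7) :
    C.wch mN mP eWord = 0 :=
  lineTwoTermUp_mu_eq_zero_of_law 7 hPT7 h C mN mP _hmN _hmP hline hA1 F (by exact_mod_cast hrank)

end Summit.HodgeConjecture.HodgeConjecture.Cruxes.BlochSeedDiscOne.LinePhaseTorus
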